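import Summits.BirchSwinnertonDyer.BirchSwinnertonDyer.Theorems.AlignedTransportAtTwoMainConjectureTransportAlignedAtTwoOrdPlusLineWitnessLaw
import HarnessLib

/-!
# Crux C1 `MainConjectureTransportAlignedAtTwo` (stmt-BirchSwinnertonDyer-22296), line `birth`, the `Δ > 0` half (R1) of the promoted residual:
# THE TWO PARITY WITNESSES AS EXPLICIT MATRIX FAMILIES — anti-invariant classes from `(a b; c a) ∈ Γ₀(N')`, invariant classes from
# `εγε ∼ γ` — and the `λ`-law off the Kilford stratum stated against them (width seat att-p4 g12; `--supports 22296`)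

THEOREMS ONLY (no `def`, no `sorry`, no new named fact). BSD is not proved by this; C1 is not closed by this.

The companion files `…OrdPlusLineWitness` / `…OrdPlusLineWitnessLaw` reduce the `λ`-law on `{Δ(W₁) ∉ ℚ₂²}` (no sign condition) to two
real-structure parity witnesses at one admissible level `N'`: (I) an `ι`-INVARIANT class with odd plus value `n₂`, (II) an `ι`-ANTI-INVARIANT class
with odd minus value `m₁` (`ι : γ ↦ εγε`, `ε = diag(−1,1)`; `ι_*{∞,γ∞} = {∞,(εγε)∞}`). This file names the classes by matrices, so that the two
witnesses become statements about explicit modular symbols `{∞, a/c}`: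
* §1 `periodFunctional_inv` (`{∞,γ⁻¹∞} = −{∞,γ∞}`), `periodFunctional_conj` (`{∞,(δγδ⁻¹)∞} = {∞,γ∞}`: `H₁` is abelian);
  **`periodFunctional_iotaConj_eq_neg_of_apply_eq`** — for `γ = (a b; c d) ∈ Γ₀(N')` with `a = d`, `εγε = γ⁻¹`, so the class of `γ` is
  ANTI-INVARIANT: `{∞,(εγε)∞} = −{∞,γ∞}` (these `γ` are exactly the `g` with `(gε)² = 1`, i.e. the anti-holomorphic involutions `τ ↦ g(−τ̄)` of
  `X₀(N')` whose fixed geodesics cover the real ovals); **`periodFunctional_iotaConj_eq_of_conj`** — if `εγε = δγδ⁻¹` for some `δ ∈ Γ₀(N')`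
  the class of `γ` is INVARIANT (e.g. the primitive hyperbolic `γ` translating along the fixed geodesic of `τ ↦ g(−τ̄)`, with `δ = g`).
* §2 **`lamLaw_of_not_padicSquare_of_matrix_witnesses`** — `…WitnessLaw.lamLaw_of_not_padicSquare_of_real_witnesses` with (I) := `∃ γ δ ∈ Γ₀(N')`,
  `εγε = δγδ⁻¹`, `(2D/Ω⁺(f₂))·re{∞,γ∞}_{g₂}` odd; (II) := `∃ γ = (a b; c a) ∈ Γ₀(N')`, `(2D/Ω⁻(f₁))·im{∞, a/c}_{g₁}` odd.

References: Manin 1972 §1.6 [Manin1972]; Cremona 1997 §2.1, §2.5 (real structure, `{∞,γ∞}` and conjugation) [CremonaAlgorithms1997];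
Greenberg–Vatsal 2000 §3 Rem. 3.4 [GreenbergVatsal2000]; Buzzard 2000 Prop. 2.4 [Buzzard2000LevelLoweringModTwo].
-/

noncomputable section

-- justification: the `Summit.BirchSwinnertonDyer.BirchSwinnertonDyer.…` path repeats a component (route-file convention)
set_option linter.dupNamespace false
set_option autoImplicit false

open scoped MatrixGroups ModularForm NumberField Classical
open CongruenceSubgroup Complex WeierstrassCurve IsDedekindDomain Polynomial Module
open Literature.NumberTheory.EllipticCurves Literature.NumberTheory.EllipticCurves.ModularForms
open Literature.NumberTheory.EllipticCurves.Greenberg1999 Literature.NumberTheory.EllipticCurves.GreenbergVatsal2000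
open Summit.BirchSwinnertonDyer.Rank1Residual.F1Sign2 Summit.BirchSwinnertonDyer.Rank1Residual.X1.MuLambda
open Summit.BirchSwinnertonDyer.BirchSwinnertonDyer.Theorems.ThetaLayerLambdaCongruenceAtTwo
open Summit.BirchSwinnertonDyer.BirchSwinnertonDyer.Theorems.AlignedTransportAtTwoOrdPlusLineWitnessLaw

namespace Summit.BirchSwinnertonDyer.BirchSwinnertonDyer.Theorems.AlignedTransportAtTwoOrdPlusLineWitnessClasses

/-! ## §1 Invariant and anti-invariant classes by matrices -/

section Classes

variable {N' : ℕ} [NeZero N']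

/-- `{∞, γ⁻¹∞} = −{∞, γ∞}` (Manin's homomorphism property). [cite: Manin1972, Prop. 1.4] -/
theorem periodFunctional_inv (γ : Gamma0 N') : periodFunctional N' γ⁻¹ = -periodFunctional N' γ := by
  have h := periodFunctional_mul (N := N') γ⁻¹ γ
  rw [inv_mul_cancel, periodFunctional_one] at h
  exact eq_neg_of_add_eq_zero_left h.symm

/-- `{∞, (δγδ⁻¹)∞} = {∞, γ∞}`: the period functional factors through the abelianisation. [cite: Manin1972, Prop. 1.4] -/
theorem periodFunctional_conj (γ δ : Gamma0 N') : periodFunctional N' (δ * γ * δ⁻¹) = periodFunctional N' γ := by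
  rw [periodFunctional_mul, periodFunctional_mul, periodFunctional_inv]; abel

/-- **ANTI-INVARIANT CLASSES: `γ = (a b; c d) ∈ Γ₀(N')` with `a = d` has `εγε = γ⁻¹`, hence `{∞,(εγε)∞} = −{∞,γ∞}`.**
(These `γ` are the `g ∈ Γ₀(N')` with `(gε)² = 1`, the anti-holomorphic involutions `τ ↦ g(−τ̄)` of `X₀(N')`.)
[cite: CremonaAlgorithms1997, §2.1 and §2.5] [cite: Manin1972, §1.6] -/
theorem periodFunctional_iotaConj_eq_neg_of_apply_eq (γ : Gamma0 N') (hγ : (γ : SL(2, ℤ)) 0 0 = (γ : SL(2, ℤ)) 1 1) :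
    periodFunctional N' ⟨iotaConj (γ : SL(2, ℤ)), iotaConj_coe_mem_gamma0 γ⟩ = -periodFunctional N' γ := by
  have hinv : iotaConj (γ : SL(2, ℤ)) = (γ : SL(2, ℤ))⁻¹ := by
    rw [Matrix.SpecialLinearGroup.SL2_inv_expl]
    ext i j
    fin_cases i <;> fin_cases j <;> simp [coe_iotaConj, hγ]
  have hsub : (⟨iotaConj (γ : SL(2, ℤ)), iotaConj_coe_mem_gamma0 γ⟩ : Gamma0 N') = γ⁻¹ :=
    Subtype.ext (by change iotaConj (γ : SL(2, ℤ)) = ((γ⁻¹ : Gamma0 N') : SL(2, ℤ)); rw [Subgroup.coe_inv, hinv])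
  rw [hsub, periodFunctional_inv]

/-- **INVARIANT CLASSES: if `εγε = δγδ⁻¹` for some `δ ∈ Γ₀(N')` then `{∞,(εγε)∞} = {∞,γ∞}`.** (E.g. `γ` the primitive hyperbolic element
translating along the fixed geodesic of an anti-holomorphic involution `τ ↦ g(−τ̄)`, `δ = g`: the classes of the real ovals of `X₀(N')(ℝ)`.)
[cite: CremonaAlgorithms1997, §2.1 and §2.5] [cite: Manin1972, §1.6] -/
theorem periodFunctional_iotaConj_eq_of_conj (γ δ : Gamma0 N')
    (h : (⟨iotaConj (γ : SL(2, ℤ)), iotaConj_coe_mem_gamma0 γ⟩ : Gamma0 N') = δ * γ * δ⁻¹) :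
    periodFunctional N' ⟨iotaConj (γ : SL(2, ℤ)), iotaConj_coe_mem_gamma0 γ⟩ = periodFunctional N' γ := by
  rw [h, periodFunctional_conj]

omit [NeZero N'] in
/-- For `γ = (a b; c d) ∈ Γ₀(N')` with `c ≠ 0`: `{∞, γ∞}_g = {∞, a/c}_g`. [folklore] -/
theorem cuspSymbol_eq_modularSymbol_of_ne_zero (g : CuspForm (Gamma0 N') 2) (γ : Gamma0 N') (hc : (γ : SL(2, ℤ)) 1 0 ≠ 0) :
    cuspSymbol g γ = modularSymbol g ((((γ : SL(2, ℤ)) 0 0 : ℤ) : ℚ) / (((γ : SL(2, ℤ)) 1 0 : ℤ) : ℚ)) := by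
  unfold cuspSymbol
  rw [if_neg hc]

end Classes

/-! ## §2 The `λ`-law off the Kilford stratum against the matrix witnesses -/

/-- **The `λ`-law off the Kilford stratum (no sign condition on `Δ(W₁)`) from hSD, hBz and two MATRIX witnesses at one admissible level**:
(I) `γ, δ ∈ Γ₀(N')` with `εγε = δγδ⁻¹` and `(2D/Ω⁺(f₂))·re{∞,γ∞}_{g₂}` odd; (II) `γ = (a b; c d) ∈ Γ₀(N')` with `a = d` and
`(2D/Ω⁻(f₁))·im{∞,γ∞}_{g₁}` odd. Corollary of `…OrdPlusLineWitnessLaw.lamLaw_of_not_padicSquare_of_real_witnesses` and §1.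
[cite: GreenbergVatsal2000, Thm. (1.4) and §3 Remark 3.4] [cite: Buzzard2000LevelLoweringModTwo, Prop. 2.4]
[cite: DarmonDiamondTaylor1995, §1.6 Lemma 1.38, §4.5 Thm. 4.26] [cite: MazurTateTeitelbaum1986Invent, §I.10] -/
theorem lamLaw_of_not_padicSquare_of_matrix_witnesses
    (hSD : heckeSelfDual_torsionBy_J0) (hBz : buzzard2000_multiplicityOne_gamma0)
    (W₁ : WeierstrassCurve ℚ) [W₁.IsElliptic] [W₁.IsGloballyMinimal]
    (W₂ : WeierstrassCurve ℚ) [W₂.IsElliptic] [W₂.IsGloballyMinimal]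
    (hord₁ : IsOrdinaryAt W₁ 2) (hord₂ : IsOrdinaryAt W₂ 2)
    (ht₁ : ∀ x : ℚ, ¬ HasRationalTwoTorsionX W₁ x) (ht₂ : ∀ x : ℚ, ¬ HasRationalTwoTorsionX W₂ x)
    (hΔ₂ : ∀ s : ℚ_[2], s ^ 2 ≠ (W₁.Δ : ℚ_[2]))
    {F : Type} [Field F] [NumberField F] (hF : finrank ℚ F = 3)
    {e₁ e₂ : F} (he₁ : aeval e₁ (twoDivisionUCubic W₁) = 0) (he₂ : aeval e₂ (twoDivisionUCubic W₂) = 0)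
    [NeZero (W₁.conductorNorm ℤ)] [NeZero (W₂.conductorNorm ℤ)]
    {f₁ : CuspForm (Gamma0 (W₁.conductorNorm ℤ)) 2} (hf₁ : IsNewformOf W₁ f₁)
    {f₂ : CuspForm (Gamma0 (W₂.conductorNorm ℤ)) 2} (hf₂ : IsNewformOf W₂ f₂)
    {G₁ G₂ : IwasawaAlgebra 2} (hG₁ : IsEvenBranchLiftAtTwo W₁ f₁ G₁) (hG₂ : IsEvenBranchLiftAtTwo W₂ f₂ G₂)
    {q₀ : ℕ} (hq₀ : q₀.Prime) (hq₀2 : q₀ ≠ 2) (hq₀N : ¬ q₀ ∣ W₁.conductorNorm ℤ * W₂.conductorNorm ℤ)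
    (SS : Finset ℕ) (hSS : SS = (q₀ * (W₁.conductorNorm ℤ * W₂.conductorNorm ℤ)).primeFactors.erase 2)
    (N' : ℕ) [NeZero N'] (hN' : N' = q₀ * (W₁.conductorNorm ℤ * W₂.conductorNorm ℤ) * ∏ ℓ ∈ SS, ℓ ^ 2)
    (g₁ g₂ : CuspForm (Gamma0 N') 2)
    (hg₁ : ∀ n : ℕ, cuspCoeff g₁ n = if ∃ ℓ ∈ SS, ℓ ∣ n then 0 else cuspCoeff f₁ n)
    (hg₂ : ∀ n : ℕ, cuspCoeff g₂ n = if ∃ ℓ ∈ SS, ℓ ∣ n then 0 else cuspCoeff f₂ n)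
    (hI : ∃ γ δ : Gamma0 N', (⟨iotaConj (γ : SL(2, ℤ)), iotaConj_coe_mem_gamma0 γ⟩ : Gamma0 N') = δ * γ * δ⁻¹ ∧
      ∃ u : ℤ, (2 * ((∏ ℓ ∈ SS, ℓ ^ 2 : ℕ) : ℝ) / plusPeriod f₂) * (cuspSymbol g₂ γ).re = u ∧ Odd u)
    (hII : ∃ γ : Gamma0 N', (γ : SL(2, ℤ)) 0 0 = (γ : SL(2, ℤ)) 1 1 ∧
      ∃ w : ℤ, (2 * ((∏ ℓ ∈ SS, ℓ ^ 2 : ℕ) : ℝ) / minusPeriod f₁) * (cuspSymbol g₁ γ).im = w ∧ Odd w) :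
    lam G₁ + ∑ ℓ ∈ (W₁.conductorNorm ℤ * W₂.conductorNorm ℤ).primeFactors.erase 2, lambdaCorrectionAtTwo W₁ ℓ =
      lam G₂ + ∑ ℓ ∈ (W₁.conductorNorm ℤ * W₂.conductorNorm ℤ).primeFactors.erase 2, lambdaCorrectionAtTwo W₂ ℓ := by
  obtain ⟨γ, δ, hγδ, u, hu, huodd⟩ := hI
  obtain ⟨γ', hγ', w, hw, hwodd⟩ := hII
  exact lamLaw_of_not_padicSquare_of_real_witnesses hSD hBz W₁ W₂ hord₁ hord₂ ht₁ ht₂ hΔ₂ hF he₁ he₂ hf₁ hf₂ hG₁ hG₂ hq₀ hq₀2 hq₀N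
    SS hSS N' hN' g₁ g₂ hg₁ hg₂ ⟨γ, periodFunctional_iotaConj_eq_of_conj γ δ hγδ, u, hu, huodd⟩
    ⟨γ', periodFunctional_iotaConj_eq_neg_of_apply_eq γ' hγ', w, hw, hwodd⟩

end Summit.BirchSwinnertonDyer.BirchSwinnertonDyer.Theorems.AlignedTransportAtTwoOrdPlusLineWitnessClasses

end
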